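import Summits.BirchSwinnertonDyer.Rank1Residual.X12.SexticTwistFamilyRecords
import Summits.BirchSwinnertonDyer.Rank1Residual.X12.SexticTwistBeyondWindowCurvesB
import Summits.BirchSwinnertonDyer.Rank1Residual.X12.SexticTwistBeyondWindowClassNumbers
import HarnessLib

/-!
# X12, `p = 3`, Kriz–Li corner beyond the window (records B): `BSD(E, 3)` for eight T-KL classes `199809a … 449307j` from the family theorem

HONEST FRAMING (cell `b2b-bsdres`, run/shared/lean/b2b/bsd-rank1-residual/; X12 prover owner
`b2b-bsdres-x1b`, gen 18): the goal is to DELETE the COMBINATION-SHAPED residual classes for ALL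
analytic-rank `≤ 1` curves over `ℚ` — "full BSD formula for every rank `≤ 1` curve in class `C`"
assembled STRICTLY from published theorems — so that the rank-`≤ 1` remainder becomes exactly the
CONSTRUCTION-SHAPED classes, which are TYPED (missing-input Props), NOT attempted; this is not
"finishing BSD". Class X12 stays CONSTRUCTION-SHAPED; the Kriz–Li sextic-twist corner at `p = 3` is
FAMILY-shaped and this file is PER CLASS (VALUE beyond the census window `N < 2·10⁴`; nothing is
booked here — the lane books, the referees rule). THEOREMS ONLY: no definition, NO new named fact
(net Literature debt `0`). Companion of `SexticTwistBeyondWindowRecordsA` (same statement shape,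
same PUBLISHED binders `h h107 h94 hGZ hKo hrat hCM0 hmod hCassels`, same TWO per-class data
`hDt` (a level-`N` parametrisation of `…2 ≅ E_d` with Manin constant prime to `3`) and `hN`
(conductor); see its module docstring). With records A and the seven window records, all 23 classes
`N < 5·10⁵` of hyp's T-KL table (RAM3-CENSUS §3) are instances of ONE theorem in the kernel.

| class | `d` | case (2) | (3a) | `N` |
|---|---|---|---|---|
| 199809a | `149` | `149 ≡ 5 (9)` | `h₃(−447)`: `h = 14` | `199809` |
| 209088ex | `−88` | `d < 0`, `−88 ≡ 2 (9)` | `h₃(−88)`: `h = 2` | `209088` |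
| 213867k | `89` | `≡ 8 (9)` | `h₃(−267)`: `h = 2` | `213867` |
| 308025bp | `185` | `≡ 5 (9)` | `h₃(−555)`: `h = 4` | `308025` |
| 357075be | `−115` | `d < 0`, `≡ 2 (9)` | `h₃(−115)`: `h = 2` | `357075` |
| 388800fg | `120` | `≡ 3 (9)` | `h₃(−360)`: `h(−40) = 2` | `388800` |
| 439569bl | `221` | `≡ 5 (9)` | `h₃(−663)`: `h = 16` | `439569` |
| 449307j | `129` | `≡ 3 (9)` | `h₃(−387)`: `h(−43) = 1` | `449307` |

(Cremona's `opt_man`: for `N > 400000` the optimal curve is 'probably `…1`' — classes 439569bl, 449307j;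
the records do not depend on optimality: `hDt` asks for SOME level-`N` parametrisation of `…2` with
`3 ∤ c`, which the lane tiers as it does every Manin datum.)

## References
* [KrizLi2019] D. Kriz, C. Li, Forum Math. Sigma 7 (2019) e15, Thm. 1.23 = Thm. 10.10, Cor. 10.7 (2), Thm. 9.4.
* [BurungaleFlach2024] Camb. J. Math. 12 (2024), Cor. 2. [MilneADT2006] Thm. I.7.3 (Cassels). [Miller2011LMS] Def. 1.1.
* [Cremona1997] `ecdata/allcurves`, `allisog`, `opt_man`, `manin.txt` (the eight classes). [AgasheRibetStein2006] Thm. 2.6 / 5.2.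
* HOME/b2b-bsdres-hyp/hyp/ram3/RAM3-CENSUS.md §3; HOME/b2b-bsdres-x1b/X12-ROUTE.md §22.
-/

set_option autoImplicit false

noncomputable section

open scoped Classical NumberField

open WeierstrassCurve NumberField Literature.NumberTheory.EllipticCurves
  Literature.NumberTheory.EllipticCurves.ModularForms
  Literature.NumberTheory.EllipticCurves.KrizLi2019
  Literature.NumberTheory.EllipticCurves.Rank1Residual
  Literature.NumberTheory.EllipticCurves.Rank1Residual.X12SexticTwist

namespace Summit.BirchSwinnertonDyer.Rank1Residual.X12.SexticTwistFamily

/-- **`199809a` (`d = 149`)**: `199809a2 = [0,0,1,0,−1006] ≅ E_{149}`, `199809a1 ~ 199809a2`. Inputs `hDt`,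
`hN`. (1) `149 ≡ 1 (4)` prime; `149 ≡ 5 (9)`; (3a) `h₃(−447) = 1` (`h = 14`).
[cite: KrizLi2019, Thm. 1.23 = Thm. 10.10 and Cor. 10.7 (2)] [cite: Cremona1997, ecdata/allcurves (class 199809a)] -/
theorem bsdp_three_cremona199809a_of_family
    (h : thm1010_bsdThree_overK_sexticTwist) (h107 : cor107_analyticRank_sexticTwist)
    (h94 : thm94_exists_heegnerField_h3_eq_one)
    (hGZ : ∀ (N : ℕ) [NeZero N] (W : WeierstrassCurve ℚ) (K : Type) [Field K] [NumberField K],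
      gross_zagier N W K)
    (hKo : ∀ (N : ℕ) [NeZero N] (W : WeierstrassCurve ℚ) (K : Type) [Field K] [NumberField K],
      kolyvagin N W K)
    (hrat : ∀ (N : ℕ) [NeZero N] (W : WeierstrassCurve ℚ) (K : Type) [Field K] [NumberField K],
      heegnerPointComplex_mem_range_map N W K)
    (hCM0 : bsdTriple_of_hasCM_of_L_one_ne_zero) (hmod : hasEntireLFunction_rat)
    (hCassels : bsdRHS_eq_of_isIsogenous)
    (hDt : ∃ Dt : ModularParametrizationData cremona199809a2 199809, ¬ (3 : ℤ) ∣ Dt.c)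
    (hN : cremona199809a2.conductorNorm ℤ = 199809) :
    (BSDp cremona199809a2 3 ∧ cremona199809a2.ShaFinite ∧ cremona199809a2.analyticRank = 1 ∧
        cremona199809a2.mordellWeilRank = 1) ∧
      (BSDp cremona199809a1 3 ∧ cremona199809a1.analyticRank = 1) := by
  haveI : NeZero (199809 : ℕ) := ⟨by norm_num⟩
  refine record_of_family h h107 h94 hGZ hKo hrat hCM0 hmod hCassels 149 cremona199809a2 199809
    cremona199809a2_eq hN ?_ (by norm_num) ?_ (by norm_num) hDt cremona199809a1
    isIsogenous_cremona199809a
  · exact Or.inl ⟨by norm_num, squarefree_intCast_of_prime (by norm_num : Nat.Prime 149), by norm_num⟩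
  · exact ⟨fun _ => by norm_num; exact threeClassNumberTrivial_neg447, fun h => absurd h (by norm_num)⟩

/-- **`209088ex` (`d = −88`)**: `209088ex2 = [0,0,0,0,594] ≅ E_{−88}`, `209088ex1 ~ 209088ex2`. Inputs
`hDt`, `hN`. (1) `−88 = 4·(−22)`, `−22 ≡ 2 (4)`; case (2) `d < 0`, `−88 ≡ 2 (9)`; (3a) `h₃(−88) = 1`
(`h = 2`). [cite: KrizLi2019, Thm. 1.23 = Thm. 10.10 and Cor. 10.7 (2)] [cite: Cremona1997, ecdata/allcurves (class 209088ex)] -/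
theorem bsdp_three_cremona209088ex_of_family
    (h : thm1010_bsdThree_overK_sexticTwist) (h107 : cor107_analyticRank_sexticTwist)
    (h94 : thm94_exists_heegnerField_h3_eq_one)
    (hGZ : ∀ (N : ℕ) [NeZero N] (W : WeierstrassCurve ℚ) (K : Type) [Field K] [NumberField K],
      gross_zagier N W K)
    (hKo : ∀ (N : ℕ) [NeZero N] (W : WeierstrassCurve ℚ) (K : Type) [Field K] [NumberField K],
      kolyvagin N W K)
    (hrat : ∀ (N : ℕ) [NeZero N] (W : WeierstrassCurve ℚ) (K : Type) [Field K] [NumberField K],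
      heegnerPointComplex_mem_range_map N W K)
    (hCM0 : bsdTriple_of_hasCM_of_L_one_ne_zero) (hmod : hasEntireLFunction_rat)
    (hCassels : bsdRHS_eq_of_isIsogenous)
    (hDt : ∃ Dt : ModularParametrizationData cremona209088ex2 209088, ¬ (3 : ℤ) ∣ Dt.c)
    (hN : cremona209088ex2.conductorNorm ℤ = 209088) :
    (BSDp cremona209088ex2 3 ∧ cremona209088ex2.ShaFinite ∧ cremona209088ex2.analyticRank = 1 ∧
        cremona209088ex2.mordellWeilRank = 1) ∧
      (BSDp cremona209088ex1 3 ∧ cremona209088ex1.analyticRank = 1) := by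
  haveI : NeZero (209088 : ℕ) := ⟨by norm_num⟩
  refine record_of_family h h107 h94 hGZ hKo hrat hCM0 hmod hCassels (-88) cremona209088ex2 209088
    cremona209088ex2_eq hN ?_ (by norm_num) ?_ (by norm_num) hDt cremona209088ex1
    isIsogenous_cremona209088ex
  · refine Or.inr ⟨by norm_num, by norm_num, ?_⟩
    rw [show ((-88 : ℤ) / 4) = -22 by norm_num]
    simpa using squarefree_neg_natCast (squarefree_mul_of_prime Nat.prime_two
      (by norm_num : Nat.Prime 11) (by decide))
  · exact ⟨fun h => absurd h (by norm_num), fun _ => threeClassNumberTrivial_neg88⟩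

/-- **`213867k` (`d = 89`)**: `213867k2 = [0,0,1,0,−601] ≅ E_{89}`, `213867k1 ~ 213867k2`. Inputs `hDt`, `hN`.
(1) `89 ≡ 1 (4)` prime; `89 ≡ 8 (9)`; (3a) `h₃(−267) = 1` (`h = 2`).
[cite: KrizLi2019, Thm. 1.23 = Thm. 10.10 and Cor. 10.7 (2)] [cite: Cremona1997, ecdata/allcurves (class 213867k)] -/
theorem bsdp_three_cremona213867k_of_family
    (h : thm1010_bsdThree_overK_sexticTwist) (h107 : cor107_analyticRank_sexticTwist)
    (h94 : thm94_exists_heegnerField_h3_eq_one)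
    (hGZ : ∀ (N : ℕ) [NeZero N] (W : WeierstrassCurve ℚ) (K : Type) [Field K] [NumberField K],
      gross_zagier N W K)
    (hKo : ∀ (N : ℕ) [NeZero N] (W : WeierstrassCurve ℚ) (K : Type) [Field K] [NumberField K],
      kolyvagin N W K)
    (hrat : ∀ (N : ℕ) [NeZero N] (W : WeierstrassCurve ℚ) (K : Type) [Field K] [NumberField K],
      heegnerPointComplex_mem_range_map N W K)
    (hCM0 : bsdTriple_of_hasCM_of_L_one_ne_zero) (hmod : hasEntireLFunction_rat)
    (hCassels : bsdRHS_eq_of_isIsogenous)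
    (hDt : ∃ Dt : ModularParametrizationData cremona213867k2 213867, ¬ (3 : ℤ) ∣ Dt.c)
    (hN : cremona213867k2.conductorNorm ℤ = 213867) :
    (BSDp cremona213867k2 3 ∧ cremona213867k2.ShaFinite ∧ cremona213867k2.analyticRank = 1 ∧
        cremona213867k2.mordellWeilRank = 1) ∧
      (BSDp cremona213867k1 3 ∧ cremona213867k1.analyticRank = 1) := by
  haveI : NeZero (213867 : ℕ) := ⟨by norm_num⟩
  refine record_of_family h h107 h94 hGZ hKo hrat hCM0 hmod hCassels 89 cremona213867k2 213867
    cremona213867k2_eq hN ?_ (by norm_num) ?_ (by norm_num) hDt cremona213867k1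
    isIsogenous_cremona213867k
  · exact Or.inl ⟨by norm_num, squarefree_intCast_of_prime (by norm_num : Nat.Prime 89), by norm_num⟩
  · exact ⟨fun _ => by norm_num; exact threeClassNumberTrivial_neg267, fun h => absurd h (by norm_num)⟩

/-- **`308025bp` (`d = 185`)**: `308025bp2 = [0,0,1,0,−1249] ≅ E_{185}`, `308025bp1 ~ 308025bp2`. Inputs
`hDt`, `hN`. (1) `185 = 5·37 ≡ 1 (4)`; `185 ≡ 5 (9)`; (3a) `h₃(−555) = 1` (`h = 4`).
[cite: KrizLi2019, Thm. 1.23 = Thm. 10.10 and Cor. 10.7 (2)] [cite: Cremona1997, ecdata/allcurves (class 308025bp)] -/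
theorem bsdp_three_cremona308025bp_of_family
    (h : thm1010_bsdThree_overK_sexticTwist) (h107 : cor107_analyticRank_sexticTwist)
    (h94 : thm94_exists_heegnerField_h3_eq_one)
    (hGZ : ∀ (N : ℕ) [NeZero N] (W : WeierstrassCurve ℚ) (K : Type) [Field K] [NumberField K],
      gross_zagier N W K)
    (hKo : ∀ (N : ℕ) [NeZero N] (W : WeierstrassCurve ℚ) (K : Type) [Field K] [NumberField K],
      kolyvagin N W K)
    (hrat : ∀ (N : ℕ) [NeZero N] (W : WeierstrassCurve ℚ) (K : Type) [Field K] [NumberField K],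
      heegnerPointComplex_mem_range_map N W K)
    (hCM0 : bsdTriple_of_hasCM_of_L_one_ne_zero) (hmod : hasEntireLFunction_rat)
    (hCassels : bsdRHS_eq_of_isIsogenous)
    (hDt : ∃ Dt : ModularParametrizationData cremona308025bp2 308025, ¬ (3 : ℤ) ∣ Dt.c)
    (hN : cremona308025bp2.conductorNorm ℤ = 308025) :
    (BSDp cremona308025bp2 3 ∧ cremona308025bp2.ShaFinite ∧ cremona308025bp2.analyticRank = 1 ∧
        cremona308025bp2.mordellWeilRank = 1) ∧
      (BSDp cremona308025bp1 3 ∧ cremona308025bp1.analyticRank = 1) := by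
  haveI : NeZero (308025 : ℕ) := ⟨by norm_num⟩
  refine record_of_family h h107 h94 hGZ hKo hrat hCM0 hmod hCassels 185 cremona308025bp2 308025
    cremona308025bp2_eq hN ?_ (by norm_num) ?_ (by norm_num) hDt cremona308025bp1
    isIsogenous_cremona308025bp
  · refine Or.inl ⟨by norm_num, ?_, by norm_num⟩
    have h185 : Squarefree ((5 * 37 : ℕ) : ℤ) :=
      Int.squarefree_natCast.mpr (squarefree_mul_of_prime Nat.prime_five (by norm_num) (by decide))
    simpa using h185
  · exact ⟨fun _ => by norm_num; exact threeClassNumberTrivial_neg555, fun h => absurd h (by norm_num)⟩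

/-- **`357075be` (`d = −115`)**: `357075be2 = [0,0,1,0,776] ≅ E_{−115}`, `357075be1 ~ 357075be2`. Inputs
`hDt`, `hN`. (1) `−115 = −(5·23) ≡ 1 (4)`; case (2) `d < 0`, `−115 ≡ 2 (9)`; (3a) `h₃(−115) = 1`
(`h = 2`). [cite: KrizLi2019, Thm. 1.23 = Thm. 10.10 and Cor. 10.7 (2)] [cite: Cremona1997, ecdata/allcurves (class 357075be)] -/
theorem bsdp_three_cremona357075be_of_family
    (h : thm1010_bsdThree_overK_sexticTwist) (h107 : cor107_analyticRank_sexticTwist)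
    (h94 : thm94_exists_heegnerField_h3_eq_one)
    (hGZ : ∀ (N : ℕ) [NeZero N] (W : WeierstrassCurve ℚ) (K : Type) [Field K] [NumberField K],
      gross_zagier N W K)
    (hKo : ∀ (N : ℕ) [NeZero N] (W : WeierstrassCurve ℚ) (K : Type) [Field K] [NumberField K],
      kolyvagin N W K)
    (hrat : ∀ (N : ℕ) [NeZero N] (W : WeierstrassCurve ℚ) (K : Type) [Field K] [NumberField K],
      heegnerPointComplex_mem_range_map N W K)
    (hCM0 : bsdTriple_of_hasCM_of_L_one_ne_zero) (hmod : hasEntireLFunction_rat)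
    (hCassels : bsdRHS_eq_of_isIsogenous)
    (hDt : ∃ Dt : ModularParametrizationData cremona357075be2 357075, ¬ (3 : ℤ) ∣ Dt.c)
    (hN : cremona357075be2.conductorNorm ℤ = 357075) :
    (BSDp cremona357075be2 3 ∧ cremona357075be2.ShaFinite ∧ cremona357075be2.analyticRank = 1 ∧
        cremona357075be2.mordellWeilRank = 1) ∧
      (BSDp cremona357075be1 3 ∧ cremona357075be1.analyticRank = 1) := by
  haveI : NeZero (357075 : ℕ) := ⟨by norm_num⟩
  refine record_of_family h h107 h94 hGZ hKo hrat hCM0 hmod hCassels (-115) cremona357075be2 357075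
    cremona357075be2_eq hN ?_ (by norm_num) ?_ (by norm_num) hDt cremona357075be1
    isIsogenous_cremona357075be
  · refine Or.inl ⟨by norm_num, ?_, by norm_num⟩
    simpa using squarefree_neg_natCast (squarefree_mul_of_prime Nat.prime_five
      (by norm_num : Nat.Prime 23) (by decide))
  · exact ⟨fun h => absurd h (by norm_num), fun _ => threeClassNumberTrivial_neg115⟩

/-- **`388800fg` (`d = 120`)**: `388800fg2 = [0,0,0,0,−810] ≅ E_{120}`, `388800fg1 ~ 388800fg2`. Inputs
`hDt`, `hN`. (1) `120 = 4·30`, `30 = 2·3·5 ≡ 2 (4)`; `120 ≡ 3 (9)`; (3a) `h₃(−360) = 1` (the field is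
`ℚ(√−10)`, `h(−40) = 2`). [cite: KrizLi2019, Thm. 1.23 = Thm. 10.10 and Cor. 10.7 (2)] [cite: Cremona1997, ecdata/allcurves (class 388800fg)] -/
theorem bsdp_three_cremona388800fg_of_family
    (h : thm1010_bsdThree_overK_sexticTwist) (h107 : cor107_analyticRank_sexticTwist)
    (h94 : thm94_exists_heegnerField_h3_eq_one)
    (hGZ : ∀ (N : ℕ) [NeZero N] (W : WeierstrassCurve ℚ) (K : Type) [Field K] [NumberField K],
      gross_zagier N W K)
    (hKo : ∀ (N : ℕ) [NeZero N] (W : WeierstrassCurve ℚ) (K : Type) [Field K] [NumberField K],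
      kolyvagin N W K)
    (hrat : ∀ (N : ℕ) [NeZero N] (W : WeierstrassCurve ℚ) (K : Type) [Field K] [NumberField K],
      heegnerPointComplex_mem_range_map N W K)
    (hCM0 : bsdTriple_of_hasCM_of_L_one_ne_zero) (hmod : hasEntireLFunction_rat)
    (hCassels : bsdRHS_eq_of_isIsogenous)
    (hDt : ∃ Dt : ModularParametrizationData cremona388800fg2 388800, ¬ (3 : ℤ) ∣ Dt.c)
    (hN : cremona388800fg2.conductorNorm ℤ = 388800) :
    (BSDp cremona388800fg2 3 ∧ cremona388800fg2.ShaFinite ∧ cremona388800fg2.analyticRank = 1 ∧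
        cremona388800fg2.mordellWeilRank = 1) ∧
      (BSDp cremona388800fg1 3 ∧ cremona388800fg1.analyticRank = 1) := by
  haveI : NeZero (388800 : ℕ) := ⟨by norm_num⟩
  refine record_of_family h h107 h94 hGZ hKo hrat hCM0 hmod hCassels 120 cremona388800fg2 388800
    cremona388800fg2_eq hN ?_ (by norm_num) ?_ (by norm_num) hDt cremona388800fg1
    isIsogenous_cremona388800fg
  · refine Or.inr ⟨by norm_num, by norm_num, ?_⟩
    rw [show ((120 : ℤ) / 4) = 30 by norm_num]
    have h30 : Squarefree ((2 * 3 * 5 : ℕ) : ℤ) :=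
      Int.squarefree_natCast.mpr (squarefree_mul_mul_of_prime Nat.prime_two Nat.prime_three
        Nat.prime_five (by decide) (by decide) (by decide))
    simpa using h30
  · exact ⟨fun _ => by norm_num; exact threeClassNumberTrivial_neg360, fun h => absurd h (by norm_num)⟩

/-- **`439569bl` (`d = 221`)**: `439569bl2 = [0,0,1,0,−1492] ≅ E_{221}`, `439569bl1 ~ 439569bl2`. Inputs
`hDt`, `hN`. (1) `221 = 13·17 ≡ 1 (4)`; `221 ≡ 5 (9)`; (3a) `h₃(−663) = 1` (`h = 16`).
[cite: KrizLi2019, Thm. 1.23 = Thm. 10.10 and Cor. 10.7 (2)] [cite: Cremona1997, ecdata/allcurves (class 439569bl)] -/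
theorem bsdp_three_cremona439569bl_of_family
    (h : thm1010_bsdThree_overK_sexticTwist) (h107 : cor107_analyticRank_sexticTwist)
    (h94 : thm94_exists_heegnerField_h3_eq_one)
    (hGZ : ∀ (N : ℕ) [NeZero N] (W : WeierstrassCurve ℚ) (K : Type) [Field K] [NumberField K],
      gross_zagier N W K)
    (hKo : ∀ (N : ℕ) [NeZero N] (W : WeierstrassCurve ℚ) (K : Type) [Field K] [NumberField K],
      kolyvagin N W K)
    (hrat : ∀ (N : ℕ) [NeZero N] (W : WeierstrassCurve ℚ) (K : Type) [Field K] [NumberField K],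
      heegnerPointComplex_mem_range_map N W K)
    (hCM0 : bsdTriple_of_hasCM_of_L_one_ne_zero) (hmod : hasEntireLFunction_rat)
    (hCassels : bsdRHS_eq_of_isIsogenous)
    (hDt : ∃ Dt : ModularParametrizationData cremona439569bl2 439569, ¬ (3 : ℤ) ∣ Dt.c)
    (hN : cremona439569bl2.conductorNorm ℤ = 439569) :
    (BSDp cremona439569bl2 3 ∧ cremona439569bl2.ShaFinite ∧ cremona439569bl2.analyticRank = 1 ∧
        cremona439569bl2.mordellWeilRank = 1) ∧
      (BSDp cremona439569bl1 3 ∧ cremona439569bl1.analyticRank = 1) := by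
  haveI : NeZero (439569 : ℕ) := ⟨by norm_num⟩
  refine record_of_family h h107 h94 hGZ hKo hrat hCM0 hmod hCassels 221 cremona439569bl2 439569
    cremona439569bl2_eq hN ?_ (by norm_num) ?_ (by norm_num) hDt cremona439569bl1
    isIsogenous_cremona439569bl
  · refine Or.inl ⟨by norm_num, ?_, by norm_num⟩
    have h221 : Squarefree ((13 * 17 : ℕ) : ℤ) :=
      Int.squarefree_natCast.mpr (squarefree_mul_of_prime (by norm_num) (by norm_num) (by decide))
    simpa using h221
  · exact ⟨fun _ => by norm_num; exact threeClassNumberTrivial_neg663, fun h => absurd h (by norm_num)⟩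

/-- **`449307j` (`d = 129`)**: `449307j2 = [0,0,1,0,−871] ≅ E_{129}`, `449307j1 ~ 449307j2`. Inputs `hDt`,
`hN`. (1) `129 = 3·43 ≡ 1 (4)`; `129 ≡ 3 (9)`; (3a) `h₃(−387) = 1` (the field is `ℚ(√−43)`, `h = 1`).
[cite: KrizLi2019, Thm. 1.23 = Thm. 10.10 and Cor. 10.7 (2)] [cite: Cremona1997, ecdata/allcurves (class 449307j)] -/
theorem bsdp_three_cremona449307j_of_family
    (h : thm1010_bsdThree_overK_sexticTwist) (h107 : cor107_analyticRank_sexticTwist)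
    (h94 : thm94_exists_heegnerField_h3_eq_one)
    (hGZ : ∀ (N : ℕ) [NeZero N] (W : WeierstrassCurve ℚ) (K : Type) [Field K] [NumberField K],
      gross_zagier N W K)
    (hKo : ∀ (N : ℕ) [NeZero N] (W : WeierstrassCurve ℚ) (K : Type) [Field K] [NumberField K],
      kolyvagin N W K)
    (hrat : ∀ (N : ℕ) [NeZero N] (W : WeierstrassCurve ℚ) (K : Type) [Field K] [NumberField K],
      heegnerPointComplex_mem_range_map N W K)
    (hCM0 : bsdTriple_of_hasCM_of_L_one_ne_zero) (hmod : hasEntireLFunction_rat)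
    (hCassels : bsdRHS_eq_of_isIsogenous)
    (hDt : ∃ Dt : ModularParametrizationData cremona449307j2 449307, ¬ (3 : ℤ) ∣ Dt.c)
    (hN : cremona449307j2.conductorNorm ℤ = 449307) :
    (BSDp cremona449307j2 3 ∧ cremona449307j2.ShaFinite ∧ cremona449307j2.analyticRank = 1 ∧
        cremona449307j2.mordellWeilRank = 1) ∧
      (BSDp cremona449307j1 3 ∧ cremona449307j1.analyticRank = 1) := by
  haveI : NeZero (449307 : ℕ) := ⟨by norm_num⟩
  refine record_of_family h h107 h94 hGZ hKo hrat hCM0 hmod hCassels 129 cremona449307j2 449307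
    cremona449307j2_eq hN ?_ (by norm_num) ?_ (by norm_num) hDt cremona449307j1
    isIsogenous_cremona449307j
  · refine Or.inl ⟨by norm_num, ?_, by norm_num⟩
    have h129 : Squarefree ((3 * 43 : ℕ) : ℤ) :=
      Int.squarefree_natCast.mpr (squarefree_mul_of_prime Nat.prime_three (by norm_num) (by decide))
    simpa using h129
  · exact ⟨fun _ => by norm_num; exact threeClassNumberTrivial_neg387, fun h => absurd h (by norm_num)⟩

end Summit.BirchSwinnertonDyer.Rank1Residual.X12.SexticTwistFamily

end
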